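import Mathlib
import Summits.ValiantsHypothesis.ValiantsHypothesis.Theorems.ChowBorderDepth3ChowBorderBoundDefs
import Literature.Computability.AlgebraicComplexity.PermanentIrreducible
import Summits.ValiantsHypothesis.ValiantsHypothesis.Theorems.ChowBorderDepth3ChowBorderBoundGoodPerm
import Summits.ValiantsHypothesis.ValiantsHypothesis.Theorems.ChowBorderDepth3ChowBorderBoundMonomialLowerBoundFormula

/-!
# Stub `stub_monomialLowerBound` of crux `ChowBorderDepth3.ChowBorderBound`
# (stmt-ValiantsHypothesis-5936), line `registered`

The lower-bound end of the top-fan-in-`2` rung of the bounded-top-fan-in line: for an arbitrary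
monomial denominator `g = κ · x^β` (`κ ≠ 0`) of the `n × n` matrix variables and every
`1 ≤ s ≤ n/4` we exhibit at least `C(⌊n/4⌋, s)` words `u` of length `s` whose quotient-derivative
numerators `quotDerivNum perₙ g u = g^(s+1) · ∂_u (perₙ / g)` are linearly independent over `ℂ`.

## Proof

Write `perₙ = ∑_ρ x^(μ_ρ)` (`μ_ρ` the permutation monomial of `ρ`).  All words used are
injective words of DIAGONAL cells `(i, i)`.  The calculus — the monomial formula
`quotDerivNum x^(μ_ρ) (κ x^β) u = κ^s ∏_k (μ_ρ (u k) − β (u k)) · x^E`, `E` characterised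
pointwise by `E w + [w ∈ u] = μ_ρ w + s β w`, for honest `ρ` (`μ_ρ + β ≥ 1` on the letters), and
the vanishing for `ρ` missing a letter outside the support of `β` — is in the companion file
`…MonomialLowerBoundFormula.lean`.

* **Family 1: words inside the support of `β`.**  Then every `ρ` is honest.  Fix a word `u` and a
  permutation `ρ*` avoiding its (fewer than `n`) cells (`GoodPerm.stub_goodPerm`); the exponent
  `E(ρ*, u)` occurs in `quotDerivNum perₙ g u'` only for `u' = u` and there only from `ρ = ρ*`
  (compare the pointwise characterisations on the cells of `ρ*`), with the non-zero coefficient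
  `κ^s ∏ (0 − β v)`.
* **Family 2: diagonal words outside the support of `β`.**  For `ρ` not containing the word the
  numerator vanishes; for `ρ` containing it the coefficient is `κ^s`.  The exponent `E(1, u)`
  (identity permutation) occurs in `quotDerivNum perₙ g u'` only for `u' = u`, `ρ = 1` (a cell of
  `u` missing from `u'` forces `ρ` off the diagonal in that row, where the identity has nothing).
* **Count.**  Of the `n` diagonal cells either at least `n/4` lie in the support of `β`
  (Family 1) or more than `n − n/4 ≥ n/4` lie outside it (Family 2); the `s`-subsets of the
  relevant diagonal cells, enumerated increasingly, give `C(·, s) ≥ C(n/4, s)` words, and a family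
  with private witness monomials is linearly independent (extract that coefficient).

References: P. Dutta, P. Dwivedi, N. Saxena, *Demystifying the border of depth-3 algebraic
circuits*, FOCS 2021 (DiDIL); the computation itself is folklore calculus.
-/

-- `Summit.ValiantsHypothesis.ValiantsHypothesis.…` is the tree's mandated single-conjunct layout
-- (Sub = Summit), so the duplicated namespace component is intended.
set_option linter.dupNamespace false

namespace Summit.ValiantsHypothesis.ValiantsHypothesis.Theorems.ChowBorderBound.MonomialLowerBound

open MvPolynomial
open Summit.ValiantsHypothesis.ValiantsHypothesis.Theorems.ChowBorderBound.QuotDeriv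
open Literature.Computability.AlgebraicComplexity

section Permanent

variable {n s : ℕ}

/-! ### §3 The two families -/

/-- **Family 1, uniqueness of the witness.**  Words `u`, `u'` inside the support of `β`, `ρ` a
permutation avoiding the cells of `u`: if the exponent of `(ρ', u')` is the exponent of `(ρ, u)`
then `ρ' = ρ` and `u'` passes through every cell of `u`. -/
theorem exponent_eq_family1 (β : Fin n × Fin n →₀ ℕ) (u u' : Fin s → Fin n × Fin n)
    (hu : Function.Injective u) (hu' : Function.Injective u')
    (hβ : ∀ k, 1 ≤ β (u k)) (hβ' : ∀ k, 1 ≤ β (u' k)) (ρ ρ' : Equiv.Perm (Fin n))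
    (havoid : ∀ i k, u k ≠ (ρ i, i))
    (hE : permMonomial ρ' + s • β - ∑ k, Finsupp.single (u' k) 1 =
      permMonomial ρ + s • β - ∑ k, Finsupp.single (u k) 1) :
    ρ' = ρ ∧ ∀ k, ∃ k', u' k' = u k := by
  have hgood : ∀ k, 1 ≤ permMonomial ρ (u k) + β (u k) := fun k => by
    have := hβ k; omega
  have hgood' : ∀ k, 1 ≤ permMonomial ρ' (u' k) + β (u' k) := fun k => by
    have := hβ' k; omega
  have H : ∀ w, ∃ e : ℕ, e + (if ∃ k, u' k = w then 1 else 0) = permMonomial ρ' w + s * β w ∧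
      e + (if ∃ k, u k = w then 1 else 0) = permMonomial ρ w + s * β w := fun w => by
    have h2 := exponent_spec β u hu ρ hgood w
    rw [← hE] at h2
    exact ⟨_, exponent_spec β u' hu' ρ' hgood' w, h2⟩
  have hρ : ρ' = ρ := by
    refine Equiv.ext fun i => ?_
    obtain ⟨e, h1, h2⟩ := H (ρ i, i)
    rw [if_neg fun ⟨k, hk⟩ => havoid i k hk, permMonomial_apply, if_pos rfl] at h2
    rw [permMonomial_apply] at h1
    by_contra hne
    rw [if_neg hne] at h1
    split_ifs at h1 <;> omega
  refine ⟨hρ, fun k => ?_⟩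
  subst hρ
  obtain ⟨e, h1, h2⟩ := H (u k)
  rw [if_pos ⟨k, rfl⟩] at h2
  by_contra hk
  rw [if_neg hk] at h1
  omega

/-- **Family 2, uniqueness of the witness.**  Diagonal words `u`, `u'`, `ρ` a permutation through
every cell of `u'`: if the exponent of `(ρ, u')` is the exponent of `(1, u)` then `u'` passes
through every cell of `u`. -/
theorem exponent_eq_family2 (β : Fin n × Fin n →₀ ℕ) (u u' : Fin s → Fin n × Fin n)
    (hu : Function.Injective u) (hu' : Function.Injective u')
    (hdiag : ∀ k, (u k).1 = (u k).2) (hdiag' : ∀ k, (u' k).1 = (u' k).2)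
    (ρ : Equiv.Perm (Fin n)) (hρ : ∀ k, ρ (u' k).2 = (u' k).1)
    (hE : permMonomial ρ + s • β - ∑ k, Finsupp.single (u' k) 1 =
      permMonomial 1 + s • β - ∑ k, Finsupp.single (u k) 1) :
    ∀ k, ∃ k', u' k' = u k := by
  have hgood : ∀ k, 1 ≤ permMonomial 1 (u k) + β (u k) := fun k => by
    rw [permMonomial_apply', Equiv.Perm.one_apply, if_pos (hdiag k).symm]; omega
  have hgood' : ∀ k, 1 ≤ permMonomial ρ (u' k) + β (u' k) := fun k => by
    rw [permMonomial_apply', if_pos (hρ k)]; omega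
  have H : ∀ w, ∃ e : ℕ, e + (if ∃ k, u' k = w then 1 else 0) = permMonomial ρ w + s * β w ∧
      e + (if ∃ k, u k = w then 1 else 0) = permMonomial 1 w + s * β w := fun w => by
    have h2 := exponent_spec β u hu 1 hgood w
    rw [← hE] at h2
    exact ⟨_, exponent_spec β u' hu' ρ hgood' w, h2⟩
  intro k
  by_contra hk
  -- at the cell `u k = (r, r)`, missing from `u'`, the permutation `ρ` has nothing
  obtain ⟨e, h1, h2⟩ := H (u k)
  rw [if_neg hk, permMonomial_apply'] at h1
  rw [if_pos ⟨k, rfl⟩, permMonomial_apply', Equiv.Perm.one_apply, if_pos (hdiag k).symm] at h2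
  have hρk : ρ (u k).2 ≠ (u k).1 := by
    intro h; rw [if_pos h] at h1; omega
  -- so its cell `((u k).1, c)` in that row is off the diagonal, where the identity has nothing
  have hc : ρ.symm (u k).1 ≠ (u k).2 := by
    intro h; apply hρk; rw [← h, Equiv.apply_symm_apply]
  have hc' : ρ.symm (u k).1 ≠ (u k).1 := fun h => hc (h.trans (hdiag k))
  obtain ⟨e', h1', h2'⟩ := H ((u k).1, ρ.symm (u k).1)
  have hn1 : ¬ ∃ k', u' k' = ((u k).1, ρ.symm (u k).1) := by
    rintro ⟨k', hk'⟩
    have := hdiag' k'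
    rw [hk'] at this
    exact hc' this.symm
  have hn2 : ¬ ∃ k', u k' = ((u k).1, ρ.symm (u k).1) := by
    rintro ⟨k', hk'⟩
    have := hdiag k'
    rw [hk'] at this
    exact hc' this.symm
  rw [if_neg hn1, permMonomial_apply, Equiv.apply_symm_apply, if_pos rfl] at h1'
  rw [if_neg hn2, permMonomial_apply, Equiv.Perm.one_apply, if_neg hc'] at h2'
  omega

/-- **Family 1 is linearly independent**: injective words inside the support of `β`, pairwise
with different sets of cells, fewer than `n` letters. -/
theorem linearIndependent_family1 (β : Fin n × Fin n →₀ ℕ) (κ : ℂ) (hκ : κ ≠ 0) (hsn : s < n)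
    (Γ : Finset (Fin s → Fin n × Fin n)) (hinj : ∀ u ∈ Γ, Function.Injective u)
    (hβ : ∀ u ∈ Γ, ∀ k, 1 ≤ β (u k))
    (hext : ∀ u ∈ Γ, ∀ u' ∈ Γ, (∀ k, ∃ k', u' k' = u k) → u = u') :
    LinearIndependent ℂ fun u : Γ =>
      quotDerivNum (perPoly (Fin n) ℂ) (C κ * monomial β 1) (List.ofFn u.1) := by
  -- every permutation is honest for every word of `Γ`
  have hgood : ∀ (u : Γ) (ρ : Equiv.Perm (Fin n)) (k : Fin s),
      1 ≤ permMonomial ρ (u.1 k) + β (u.1 k) := fun u ρ k => by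
    have := hβ u.1 u.2 k; omega
  -- a permutation avoiding the (fewer than `n`) cells of each word
  have havoid : ∀ u : Γ, ∃ ρ : Equiv.Perm (Fin n), ∀ i k, u.1 k ≠ (ρ i, i) := by
    intro u
    have hcard : (Finset.univ.image u.1).card < n :=
      lt_of_le_of_lt Finset.card_image_le
        (by rw [Finset.card_univ, Fintype.card_fin]; exact hsn)
    obtain ⟨ρ, -, -, hρ, -⟩ := GoodPerm.stub_goodPerm n (Finset.univ.image u.1) hcard
    exact ⟨ρ, fun i k hk => hρ i (Finset.mem_image.2 ⟨k, Finset.mem_univ _, hk⟩)⟩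
  choose ρs hρs using havoid
  refine linearIndependent_of_coeff_witness _
    (fun u => permMonomial (ρs u) + s • β - ∑ k, Finsupp.single (u.1 k) 1) ?_ ?_
  · intro u
    rw [coeff_quotDerivNum_perPoly, Finset.sum_eq_single (ρs u)]
    · rw [quotDerivNum_permMonomial β κ u.1 (hinj u.1 u.2) (ρs u) (hgood u _), coeff_monomial,
        if_pos rfl]
      refine mul_ne_zero (pow_ne_zero _ hκ) (Finset.prod_ne_zero_iff.2 fun k _ => ?_)
      have h0 : permMonomial (ρs u) (u.1 k) = 0 := by
        rw [permMonomial_apply']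
        refine if_neg fun h => hρs u (u.1 k).2 k ?_
        rw [h]
      rw [h0, Nat.cast_zero, zero_sub, neg_ne_zero, Nat.cast_ne_zero]
      have := hβ u.1 u.2 k
      omega
    · intro ρ _ hρ
      rw [quotDerivNum_permMonomial β κ u.1 (hinj u.1 u.2) ρ (hgood u ρ), coeff_monomial, if_neg]
      intro hE
      exact hρ (exponent_eq_family1 β u.1 u.1 (hinj _ u.2) (hinj _ u.2) (hβ _ u.2) (hβ _ u.2)
        (ρs u) ρ (hρs u) hE).1
    · intro h
      exact absurd (Finset.mem_univ _) h
  · intro u u' hne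
    rw [coeff_quotDerivNum_perPoly]
    refine Finset.sum_eq_zero fun ρ _ => ?_
    rw [quotDerivNum_permMonomial β κ u'.1 (hinj u'.1 u'.2) ρ (hgood u' ρ), coeff_monomial,
      if_neg]
    intro hE
    obtain ⟨-, hk⟩ := exponent_eq_family1 β u.1 u'.1 (hinj _ u.2) (hinj _ u'.2) (hβ _ u.2)
      (hβ _ u'.2) (ρs u) ρ (hρs u) hE
    exact hne (Subtype.ext (hext u.1 u.2 u'.1 u'.2 hk))

/-- **Family 2 is linearly independent**: injective diagonal words outside the support of `β`,
pairwise with different sets of cells. -/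
theorem linearIndependent_family2 (β : Fin n × Fin n →₀ ℕ) (κ : ℂ) (hκ : κ ≠ 0)
    (Γ : Finset (Fin s → Fin n × Fin n)) (hinj : ∀ u ∈ Γ, Function.Injective u)
    (hdiag : ∀ u ∈ Γ, ∀ k, (u k).1 = (u k).2) (hβ : ∀ u ∈ Γ, ∀ k, β (u k) = 0)
    (hext : ∀ u ∈ Γ, ∀ u' ∈ Γ, (∀ k, ∃ k', u' k' = u k) → u = u') :
    LinearIndependent ℂ fun u : Γ =>
      quotDerivNum (perPoly (Fin n) ℂ) (C κ * monomial β 1) (List.ofFn u.1) := by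
  -- the identity is honest for every word of `Γ`
  have hgood1 : ∀ (u : Γ) (k : Fin s), 1 ≤ permMonomial 1 (u.1 k) + β (u.1 k) := fun u k => by
    rw [permMonomial_apply', Equiv.Perm.one_apply, if_pos (hdiag u.1 u.2 k).symm]; omega
  -- honest / vanishing dichotomy
  have hgb : ∀ (u : Γ) (ρ : Equiv.Perm (Fin n)),
      (∀ k, 1 ≤ permMonomial ρ (u.1 k) + β (u.1 k)) ∨
        quotDerivNum (monomial (permMonomial ρ) 1) (C κ * monomial β 1) (List.ofFn u.1) = 0 := by
    intro u ρ
    by_cases h : ∀ k, ρ (u.1 k).2 = (u.1 k).1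
    · exact Or.inl fun k => by rw [permMonomial_apply', if_pos (h k)]; omega
    · push Not at h
      obtain ⟨k, hk⟩ := h
      refine Or.inr (quotDerivNum_permMonomial_eq_zero β κ _ ρ (u.1 k)
        (List.mem_ofFn.2 ⟨k, rfl⟩) ?_ (hβ u.1 u.2 k))
      rw [permMonomial_apply', if_neg hk]
  have hthrough : ∀ (u : Γ) (ρ : Equiv.Perm (Fin n)),
      (∀ k, 1 ≤ permMonomial ρ (u.1 k) + β (u.1 k)) → ∀ k, ρ (u.1 k).2 = (u.1 k).1 := by
    intro u ρ hg k
    have h1 := hg k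
    rw [permMonomial_apply', hβ u.1 u.2 k] at h1
    by_contra h
    rw [if_neg h] at h1
    omega
  refine linearIndependent_of_coeff_witness _
    (fun u => permMonomial 1 + s • β - ∑ k, Finsupp.single (u.1 k) 1) ?_ ?_
  · intro u
    rw [coeff_quotDerivNum_perPoly, Finset.sum_eq_single 1]
    · rw [quotDerivNum_permMonomial β κ u.1 (hinj u.1 u.2) 1 (hgood1 u), coeff_monomial,
        if_pos rfl]
      refine mul_ne_zero (pow_ne_zero _ hκ) (Finset.prod_ne_zero_iff.2 fun k _ => ?_)
      rw [permMonomial_apply', Equiv.Perm.one_apply, if_pos (hdiag u.1 u.2 k).symm, hβ u.1 u.2 k]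
      norm_num
    · intro ρ _ hρ
      rcases hgb u ρ with hg | hz
      · rw [quotDerivNum_permMonomial β κ u.1 (hinj u.1 u.2) ρ hg, coeff_monomial, if_neg]
        intro hE
        exact hρ (perm_eq_of_exponent_eq β u.1 (hinj _ u.2) 1 ρ (hgood1 u) hg hE)
      · rw [hz, coeff_zero]
    · intro h
      exact absurd (Finset.mem_univ _) h
  · intro u u' hne
    rw [coeff_quotDerivNum_perPoly]
    refine Finset.sum_eq_zero fun ρ _ => ?_
    rcases hgb u' ρ with hg | hz
    · rw [quotDerivNum_permMonomial β κ u'.1 (hinj u'.1 u'.2) ρ hg, coeff_monomial, if_neg]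
      intro hE
      exact hne (Subtype.ext (hext u.1 u.2 u'.1 u'.2 (exponent_eq_family2 β u.1 u'.1
        (hinj _ u.2) (hinj _ u'.2) (hdiag _ u.2) (hdiag _ u'.2) ρ (hthrough u' ρ hg) hE)))
    · rw [hz, coeff_zero]

/-! ### §4 Diagonal words and the count -/

/-- The increasing enumerations of the `s`-subsets of a set `X` of diagonal positions, as words of
diagonal cells: `C(|X|, s)` injective diagonal words in `X`, pairwise with different cell sets. -/
theorem exists_diagonal_words (X : Finset (Fin n)) (s : ℕ) :
    ∃ Γ : Finset (Fin s → Fin n × Fin n), Γ.card = X.card.choose s ∧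
      (∀ u ∈ Γ, Function.Injective u) ∧
      (∀ u ∈ Γ, ∀ k, (u k).1 = (u k).2 ∧ (u k).2 ∈ X) ∧
      (∀ u ∈ Γ, ∀ u' ∈ Γ, (∀ k, ∃ k', u' k' = u k) → u = u') := by
  classical
  have hc : ∀ I : X.powersetCard s, I.1.card = s := fun I => (Finset.mem_powersetCard.1 I.2).2
  obtain ⟨word, hword⟩ : ∃ word : X.powersetCard s → Fin s → Fin n × Fin n,
      ∀ I k, word I k = (I.1.orderEmbOfFin (hc I) k, I.1.orderEmbOfFin (hc I) k) :=
    ⟨_, fun _ _ => rfl⟩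
  have hrange : ∀ (I : X.powersetCard s) (i : Fin n), (∃ k, word I k = (i, i)) ↔ i ∈ I.1 := by
    intro I i
    constructor
    · rintro ⟨k, hk⟩
      rw [hword, Prod.mk.injEq] at hk
      rw [← hk.1]
      exact Finset.orderEmbOfFin_mem I.1 (hc I) k
    · intro hi
      have : i ∈ Set.range (I.1.orderEmbOfFin (hc I)) := by
        rw [Finset.range_orderEmbOfFin]
        exact hi
      obtain ⟨k, hk⟩ := this
      exact ⟨k, by rw [hword, hk]⟩
  have hinjw : Function.Injective word := by
    intro I J h
    apply Subtype.ext
    ext i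
    rw [← hrange I i, ← hrange J i, h]
  refine ⟨Finset.univ.image word, ?_, ?_, ?_, ?_⟩
  · rw [Finset.card_image_of_injective _ hinjw, Finset.card_univ, Fintype.card_coe,
      Finset.card_powersetCard]
  · intro u hu
    obtain ⟨I, -, rfl⟩ := Finset.mem_image.1 hu
    intro k k' h
    rw [hword, hword, Prod.mk.injEq] at h
    exact (I.1.orderEmbOfFin (hc I)).injective h.1
  · intro u hu k
    obtain ⟨I, -, rfl⟩ := Finset.mem_image.1 hu
    rw [hword]
    exact ⟨rfl, (Finset.mem_powersetCard.1 I.2).1 (Finset.orderEmbOfFin_mem I.1 (hc I) k)⟩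
  · intro u hu u' hu' h
    obtain ⟨I, -, rfl⟩ := Finset.mem_image.1 hu
    obtain ⟨J, -, rfl⟩ := Finset.mem_image.1 hu'
    have hIJ : I = J := by
      apply Subtype.ext
      apply Finset.eq_of_subset_of_card_le
      · intro i hi
        obtain ⟨k, hk⟩ := (hrange I i).2 hi
        obtain ⟨k', hk'⟩ := h k
        exact (hrange J i).1 ⟨k', hk'.trans hk⟩
      · rw [hc I, hc J]
    rw [hIJ]

end Permanent

/-- **Stub `stub_monomialLowerBound`** (registered stub W5 of crux stmt-ValiantsHypothesis-5936,
line `registered`): for every monomial denominator `κ x^β` (`κ ≠ 0`) of the `n × n` matrix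
variables and every `1 ≤ s` with `4 s ≤ n` there are at least `C(⌊n/4⌋, s)` words `u` of length
`s` whose quotient-derivative numerators `quotDerivNum perₙ (κ x^β) u` are linearly independent
over `ℂ`. -/
theorem stub_monomialLowerBound :
    ∀ (n : ℕ) (β : (Fin n × Fin n) →₀ ℕ) (κ : ℂ), κ ≠ 0 → ∀ s : ℕ, 1 ≤ s → 4 * s ≤ n →
      ∃ Γ : Finset (Fin s → Fin n × Fin n), (n / 4).choose s ≤ Γ.card ∧
        LinearIndependent ℂ (fun u : Γ =>
          Summit.ValiantsHypothesis.ValiantsHypothesis.Theorems.ChowBorderBound.QuotDeriv.quotDerivNum (Literature.Computability.AlgebraicComplexity.perPoly (Fin n) ℂ)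
            (MvPolynomial.C κ * MvPolynomial.monomial β 1) (List.ofFn fun k => u.1 k)) := by
  intro n β κ hκ s hs hsn
  classical
  -- the diagonal positions outside / inside the support of `β`
  have hsum : (Finset.univ.filter fun i : Fin n => β (i, i) = 0).card +
      (Finset.univ.filter fun i : Fin n => ¬ β (i, i) = 0).card = n := by
    rw [Finset.card_filter_add_card_filter_not, Finset.card_univ, Fintype.card_fin]
  by_cases h1 : n / 4 ≤ (Finset.univ.filter fun i : Fin n => ¬ β (i, i) = 0).card
  · -- Family 1
    obtain ⟨Γ, hcard, hinj, hmem, hext⟩ :=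
      exists_diagonal_words (Finset.univ.filter fun i : Fin n => ¬ β (i, i) = 0) s
    refine ⟨Γ, ?_, ?_⟩
    · rw [hcard]
      exact Nat.choose_le_choose s h1
    · refine linearIndependent_family1 β κ hκ (by omega) Γ hinj (fun u hu k => ?_) hext
      obtain ⟨h1, h2⟩ := hmem u hu k
      rw [Finset.mem_filter] at h2
      have e : u k = ((u k).2, (u k).2) := Prod.ext h1 rfl
      rw [e]
      have := h2.2
      omega
  · -- Family 2
    obtain ⟨Γ, hcard, hinj, hmem, hext⟩ :=
      exists_diagonal_words (Finset.univ.filter fun i : Fin n => β (i, i) = 0) s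
    refine ⟨Γ, ?_, ?_⟩
    · rw [hcard]
      exact Nat.choose_le_choose s (by omega)
    · refine linearIndependent_family2 β κ hκ Γ hinj (fun u hu k => (hmem u hu k).1)
        (fun u hu k => ?_) hext
      obtain ⟨h1, h2⟩ := hmem u hu k
      rw [Finset.mem_filter] at h2
      have e : u k = ((u k).2, (u k).2) := Prod.ext h1 rfl
      rw [e]
      exact h2.2

end Summit.ValiantsHypothesis.ValiantsHypothesis.Theorems.ChowBorderBound.MonomialLowerBound
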